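import Literature.IUT.HodgeArakelov.CyclicToyEtaleThetaData
import HarnessLib

/-!
# [IUTchII] Prop 2.2 (ii), frozen v1 `Prop22_ii` (FACT-LIST F-0675): INSTANCE FORMS (head-form, hypothesis-free) at
# the cyclic-toy carriers of record — and why no genuine-`ι` instance can exist

S. Mochizuki, *Inter-universal Teichmüller theory II: Hodge–Arakelov-theoretic evaluation*, §2, Proposition 2.2 (ii),
kurims manuscript p. 66: «The functorial group-theoretic algorithms `Π_v ↦ θ(Π_v) ⊆ ∞θ(Π_v) …` of Proposition 1.4 …,
together with the condition of invariance with respect to `ι` [cf. [EtTh], Proposition 1.4, (ii); the proof of [EtTh],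
Theorem 1.6, (iii)], determines a specific `μ_{2l}`- (respectively, `μ`-) orbit `θ^ι(Π_v) ⊆ θ(Π_v)` (respectively,
`∞θ^ι(Π_v) ⊆ ∞θ(Π_v)`) within the unique `{(l·ℤ) × μ_{2l}}`- (respectively, each `{(l·ℤ) × μ}`-) orbit contained in the
set `θ(Π_v)` (respectively, `∞θ(Π_v)`)» [cite: Mochizuki2012, II Prop 2.2 (ii) p.66].  Claim key `Mochizuki2012`, status
DISPUTED (D-0012): nothing of the series is asserted here and no side is taken on [IUTchIII] Cor. 3.12.

abc-iut cell, block F (instance-form batch INST59J2), seat abc-iut-f-110 (gen 6).  FACT-LIST row **F-0675**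
`Literature.IUT.HodgeArakelov.Prop22_ii Dec := Nonempty (IotaInvariantTheta Dec)` (abc-iut-L6-t1, frozen
`ThetaEvaluationSetting.lean`; v1 = a LITERAL `ι`-fixed class in `θ(Π_v)`, all literal fixed classes in one `2l`-torsion
class).  Kernel status before this file (LF-KERNEL-STATUS col. 14): universal closure REFUTED (abc-iut-f-045,
`not_forall_prop22_ii`: `H¹ = ℤ`, `θ(Π_v) = {0, −1}`), one conditional refuter (`not_prop22_ii_of_forall_fixed`), the
degenerate inhabitant packaged under `∃` (abc-iut's `IotaInvariantTheta.nonempty_degenerate`, `PlusMinusTowerNonVacuity.lean`)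
— but NO theorem whose conclusion HEAD is `Prop22_ii`.  PROOF-ONLY file (0 `def`, 0 `instance`, no new `Prop`; every
input BY NAME, nothing restated):

* `prop22_ii_degenerateDecomposition S T` — **INSTANCE FORM AT A TOY CARRIER (labelled)**: for EVERY bad-place setting
  `S` and EVERY Prop 2.1 diagram `T` at the reference group, the frozen v1 `Prop22_ii` holds at abc-iut-w5-d243's
  degenerate decomposition `CyclicToy.degenerateDecomposition S T (CyclicToy.degenerateEtaleThetaData S)` (zero cohomology
  `H¹ = ℤ/1`, `θ(Π_v) = ⊤`, `Π_{v•} = Π_{v▶} = 1`, `ι = id`): the `ι`-action `id` fixes the unique class and the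
  `μ_{2l}`-orbit clause is trivial in the zero group;
* `prop22_ii_cyclicDecomposition` — the CLOSED instance (0 binders) at the cyclic toy quintuple `l = 3`, `p = 5`
  (`CyclicToy.cyclicDecomposition 3 5 …`);
* WHY ONLY TOY CARRIERS (cited, not restated): by abc-iut-L6's `IotaInvariantTheta.not_exists_of_fixedPointFree`
  (`IotaInvariantThetaNegative.lean`, finding T1-N6), for every datum `Dec` whatsoever NO v1 witness has as its `ι`-action
  an automorphism moving every class of `θ(Π_v)` — the shape of the GENUINE `ι` at the §1 models (shift by `κ(−1) ≠ 0`);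
  the printed content lives in the repaired row F-0661 `Prop22_ii'` (`IotaInvariantThetaR.lean`, 45 conditional instances
  of record).  So a head-form instance of F-0675 at genuine data is not merely missing but excluded by a tree theorem;
  the toy instances here are CONSISTENCY certificates for the frozen v1 typing only.

HONEST LABEL: «INSTANCE at toy carrier» — an instance-form theorem about OUR typed (v1, superseded) statement ≠ a theorem
about [IUTchII] in print; the universal closure stays refuted; typed ≠ proved; no side taken on [IUTchIII] Cor. 3.12;
nothing here asserts abc proved or refuted.
-/

namespace Literature.IUT.HodgeArakelov

universe u

/-- **F-0675 `Prop22_ii`, INSTANCE FORM at the degenerate decomposition over ANY bad-place setting** («INSTANCE at toy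
carrier»: abc-iut-w5-d243's `CyclicToy.degenerateDecomposition` / `degenerateEtaleThetaData` — zero cohomology,
`θ(Π_v) = ⊤ = {0}`, `ι := id`): the v1 datum with `ι`-actions `id`, whose literal fixed class is `0` and whose orbit clause
holds in the zero group.  [claim: Mochizuki2012, status: disputed] (IUTchII §2 Prop 2.2 (ii), kurims p.66)
[cite: Mochizuki2012, II Prop 2.2 (ii) p.66] -/
theorem prop22_ii_degenerateDecomposition (S : BadPlaceSetting.{u}) (T : TemperedCoverings S S.PiX) :
    Literature.IUT.HodgeArakelov.Prop22_ii
      (CyclicToy.degenerateDecomposition S T (CyclicToy.degenerateEtaleThetaData S.toThetaSetting)) :=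
  ⟨{ iotaH1 := AddEquiv.refl _
     iotaLim := AddEquiv.refl _
     iota_compat := fun _ => rfl
     iota_theta := Set.image_id _
     thetaIota_nonempty := ⟨0, Set.mem_univ _, rfl⟩
     thetaIota_orbit := fun _ _ _ _ _ _ => Subsingleton.elim _ _ }⟩

/-- **F-0675 `Prop22_ii`, CLOSED INSTANCE (0 binders) at the cyclic toy quintuple `l = 3`, `p = 5`** (abc-iut-w5-d243's
`CyclicToy.cyclicDecomposition`; «INSTANCE at toy carrier»). [claim: Mochizuki2012, status: disputed]
(IUTchII §2 Prop 2.2 (ii), kurims p.66) [cite: Mochizuki2012, II Prop 2.2 (ii) p.66] -/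
theorem prop22_ii_cyclicDecomposition :
    Literature.IUT.HodgeArakelov.Prop22_ii
      (CyclicToy.cyclicDecomposition 3 5 Nat.prime_three (by decide) Nat.prime_five (by decide) (by decide)) :=
  prop22_ii_degenerateDecomposition _ _

end Literature.IUT.HodgeArakelov
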